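import Mathlib
import HarnessLib
import Summits.MatrixMultiplication.MatrixMultiplication.Theorems.FarEdgeDescentAllArities
import Summits.MatrixMultiplication.MatrixMultiplication.Theorems.FarEdgeDescentDialDegeneration

/-!
# Far-edge descent — the region criterion AT the tight endpoint `β = 2` (kernel XLVI, lens-2 g63)

Kernel XLIII (`FarEdgeDescentDialDegeneration`) showed that at the cost-free endpoint `β = 2` the floor
vanishes (`Vfloor a 2 z m = 0`) and the region criterion is TIGHT at the fixed-point pair
`(λ, λ', V, V') = (1/3, 1/3, 0, 0)`, so that no exponent `κ < κ_S` works there and no vertex certificate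
(which needs a positive margin) can ever certify `β = 2`.  This file proves the complementary, SYMBOLIC
statement: at `β = 2`, floor `0`, the region criterion HOLDS at `κ = κ_S` for every discount/regulariser
pair `(z, ε)` with `3/4 ≤ z`, `0 ≤ ε ≤ 1/3`, `z (1 + ε) ≤ 1` (`regionCriterion_two_floorZero`).  Consequences:

* `capXLD_allA_two` — **XL-D(a, 2) for every arity `a ≥ 2`** (model level), the one dial value the
  certificate method cannot reach, via `capXLD_allA_of_criterion` at `(z, ε) = (99/100, 1/100)`;
* `regionCriterion_two_iff` — at the endpoint the criterion holds **iff `κ_S ≤ κ`** (with XLIII's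
  `kappaS_le_of_regionCriterion_two`): `κ_S = log₂(4/3)` is the exact threshold of the pair inequality at
  the cost-free point, and its tight locus contains the fixed-point pair and the faces `V = 1`, `V' = 1`
  (`endpoint_face_identity`).

The proof is three lines of structure: (1) the chord bound
`A x^{κ_S} + B (1−x)^{κ_S} ≤ A + B − min(A,B)/2` (concavity of `t ↦ t^{κ_S}` and `(1/2)^{κ_S} = 3/4`);
(2) the defect identity `A + B − λ_P(ε+1−V_P) = λλ'(z α α' + w (α + α' − 1 − ε))` with `α = ε+1−V`,
`w = 1 − z(1+ε)`; (3) the branch inequality `2·defect ≤ A` (and `≤ B`), which is affine in `α` and reduces at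
the two ends `α ∈ {ε, 1+ε}` to `(1+ε)(1−3λ') + 2λ'V' ≥ 0` and `ε(1−3λ') + 2λ'(1−z)V' ≥ 0` — both consequences
of the WEDGE constraint alone (the pin is not used).  No `sorry`.
-/

noncomputable section

set_option linter.dupNamespace false
set_option linter.style.longLine false

namespace Summit.MatrixMultiplication.MatrixMultiplication.Theorems.FarEdgeDescentEndpointCriterion

open Finset
open Summit.MatrixMultiplication.MatrixMultiplication.Theorems.FarEdgeDescentFloorDial
open Summit.MatrixMultiplication.MatrixMultiplication.Theorems.FarEdgeDescentFloorDial.Sched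
open Summit.MatrixMultiplication.MatrixMultiplication.Theorems.FarEdgeDescentNarrownessPotential
open Summit.MatrixMultiplication.MatrixMultiplication.Theorems.FarEdgeDescentFloorNarrowness
open Summit.MatrixMultiplication.MatrixMultiplication.Theorems.FarEdgeDescentTreeCapTools
open Summit.MatrixMultiplication.MatrixMultiplication.Theorems.FarEdgeDescentAllArities
open Summit.MatrixMultiplication.MatrixMultiplication.Theorems.FarEdgeDescentDialDegeneration

/-! ## 1. The chord bound at `κ_S` -/

/-- `κ_S > 0` (from `17/41 ≤ κ_S`). -/
theorem kappaS_pos : 0 < Real.log (4 / 3) / Real.log 2 := lt_of_lt_of_le (by norm_num) kappaS_ge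

/-- `κ_S < 1` (from `κ_S ≤ 22/53`). -/
theorem kappaS_lt_one : Real.log (4 / 3) / Real.log 2 < 1 := lt_of_le_of_lt kappaS_le (by norm_num)

/-- `x^{κ_S} + (1−x)^{κ_S} ≤ 3/2` on `[0,1]` (Jensen for the concave `t ↦ t^{κ_S}`, `(1/2)^{κ_S} = 3/4`). -/
theorem rpow_add_rpow_le_three_halves {x : ℝ} (hx0 : 0 ≤ x) (hx1 : x ≤ 1) :
    x ^ (Real.log (4 / 3) / Real.log 2) + (1 - x) ^ (Real.log (4 / 3) / Real.log 2) ≤ 3 / 2 := by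
  have hc := (Real.strictConcaveOn_rpow kappaS_pos kappaS_lt_one).concaveOn
  have h := hc.2 (Set.mem_Ici.mpr hx0) (Set.mem_Ici.mpr (by linarith : (0:ℝ) ≤ 1 - x))
    (by norm_num : (0:ℝ) ≤ 1 / 2) (by norm_num : (0:ℝ) ≤ 1 / 2) (by norm_num)
  simp only [smul_eq_mul] at h
  have hmid : (1 / 2 : ℝ) * x + 1 / 2 * (1 - x) = 1 / 2 := by ring
  rw [hmid, half_rpow_kappaS] at h
  linarith

/-- **Chord bound.** For `A, B ≥ 0` and `x ∈ [0,1]`: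
`A x^{κ_S} + B (1−x)^{κ_S} ≤ A + B − min(A,B)/2`. -/
theorem chord_bound {A B x : ℝ} (hA : 0 ≤ A) (hB : 0 ≤ B) (hx0 : 0 ≤ x) (hx1 : x ≤ 1) :
    A * x ^ (Real.log (4 / 3) / Real.log 2) + B * (1 - x) ^ (Real.log (4 / 3) / Real.log 2) ≤
      A + B - min A B / 2 := by
  set κ := Real.log (4 / 3) / Real.log 2 with hκ
  have hxk0 : 0 ≤ x ^ κ := Real.rpow_nonneg hx0 κ
  have hxk1 : x ^ κ ≤ 1 := Real.rpow_le_one hx0 hx1 kappaS_pos.le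
  have hyk0 : 0 ≤ (1 - x) ^ κ := Real.rpow_nonneg (by linarith) κ
  have hyk1 : (1 - x) ^ κ ≤ 1 := Real.rpow_le_one (by linarith) (by linarith) kappaS_pos.le
  have hS := rpow_add_rpow_le_three_halves hx0 hx1
  have hmA : min A B ≤ A := min_le_left A B
  have hmB : min A B ≤ B := min_le_right A B
  have hm0 : 0 ≤ min A B := le_min hA hB
  have e : A * x ^ κ + B * (1 - x) ^ κ =
      (A - min A B) * x ^ κ + (B - min A B) * (1 - x) ^ κ + min A B * (x ^ κ + (1 - x) ^ κ) := by ring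
  rw [e]
  nlinarith [mul_le_mul_of_nonneg_left hxk1 (sub_nonneg.mpr hmA),
    mul_le_mul_of_nonneg_left hyk1 (sub_nonneg.mpr hmB), mul_le_mul_of_nonneg_left hS hm0]

/-! ## 2. The defect identity and the branch inequality at `β = 2` -/

/-- **Defect identity** at `β = 2`: with `α = ε+1−V`, `α' = ε+1−V'`, `w = 1 − z(1+ε)`,
`A + B − (λ_P(1+ε) − num) = λ λ' (z α α' + w (α + α' − 1 − ε))`. -/
theorem defect_identity (z ε l l' V V' : ℝ) :
    (1 - (2 - 1) * l') * (l * (ε + 1 - V)) + (1 - (2 - 1) * l) * (l' * (ε + 1 - V')) -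
        ((l + l' - (2 * 2 - 1) * l * l') * (ε + 1) -
          (l' * (1 - 2 * l) * V' + l * (1 - 2 * l') * V + z * l * l' * V * V')) =
      l * l' * (z * (ε + 1 - V) * (ε + 1 - V') +
        (1 - z * (1 + ε)) * ((ε + 1 - V) + (ε + 1 - V') - 1 - ε)) := by
  ring

/-- End value `α = 1 + ε` of the branch inequality: `(1+ε)(1−3λ') + 2λ'V' ≥ 0` from the wedge. -/
theorem branch_end_one {ε l' V' : ℝ} (hε0 : 0 ≤ ε) (hε1 : ε ≤ 1 / 3) (hl'0 : 0 ≤ l') (hl'1 : 2 * l' ≤ 1)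
    (hV'0 : 0 ≤ V') (hwl' : 2 * ((2 * 2 - 1) * l' - 1) ≤ (2 - 1) * V') :
    0 ≤ (1 + ε) * (1 - 3 * l') + 2 * l' * V' := by
  rcases le_or_gt l' (1 / 3) with h | h
  · nlinarith [mul_nonneg (by linarith : (0:ℝ) ≤ 1 + ε) (by linarith : (0:ℝ) ≤ 1 - 3 * l'),
      mul_nonneg hl'0 hV'0]
  · -- V' ≥ 6 l' − 2, so the expression is ≥ (3l'−1)(4l'−1−ε) ≥ 0
    have h1 : 0 ≤ 3 * l' - 1 := by linarith
    have h2 : 0 ≤ 4 * l' - 1 - ε := by linarith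
    nlinarith [mul_nonneg h1 h2, mul_le_mul_of_nonneg_left (by linarith : 6 * l' - 2 ≤ V') (by linarith : (0:ℝ) ≤ 2 * l')]

/-- End value `α = ε` of the branch inequality: `ε(1−3λ') + 2λ'(1−z)V' ≥ 0` from the wedge and
`ε ≤ (4/3)(1−z)` (a consequence of `z(1+ε) ≤ 1`, `z ≥ 3/4`). -/
theorem branch_end_eps {z ε l' V' : ℝ} (hz : 3 / 4 ≤ z) (hε0 : 0 ≤ ε) (hw : z * (1 + ε) ≤ 1)
    (hl'0 : 0 ≤ l') (hl'1 : 2 * l' ≤ 1) (hV'0 : 0 ≤ V') (hwl' : 2 * ((2 * 2 - 1) * l' - 1) ≤ (2 - 1) * V') :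
    0 ≤ ε * (1 - 3 * l') + 2 * l' * (1 - z) * V' := by
  have hz1 : z ≤ 1 := by nlinarith
  have hε43 : ε ≤ 4 / 3 * (1 - z) := by nlinarith
  rcases le_or_gt l' (1 / 3) with h | h
  · nlinarith [mul_nonneg hε0 (by linarith : (0:ℝ) ≤ 1 - 3 * l'),
      mul_nonneg (mul_nonneg hl'0 (by linarith : (0:ℝ) ≤ 1 - z)) hV'0]
  · have h1 : 0 ≤ 3 * l' - 1 := by linarith
    have h2 : 0 ≤ 4 * l' * (1 - z) - ε := by nlinarith
    nlinarith [mul_nonneg h1 h2, mul_le_mul_of_nonneg_left (by linarith : 6 * l' - 2 ≤ V')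
      (mul_nonneg (by linarith : (0:ℝ) ≤ 2 * l') (by linarith : (0:ℝ) ≤ 1 - z))]

/-- **Branch inequality** at `β = 2`: `2 λ'·(z α α' + w(α + α' − 1 − ε)) ≤ (1 − λ') α`; it is affine
in `α = ε+1−V ∈ [ε, 1+ε]` and equals `(1−V)·E₁ + V·E₀` with the two end values above. -/
theorem branch_ineq {z ε l' V V' : ℝ} (hz : 3 / 4 ≤ z) (hε0 : 0 ≤ ε) (hε1 : ε ≤ 1 / 3)
    (hw : z * (1 + ε) ≤ 1) (hl'0 : 0 ≤ l') (hl'1 : 2 * l' ≤ 1) (hV0 : 0 ≤ V) (hV1 : V ≤ 1) (hV'0 : 0 ≤ V')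
    (hwl' : 2 * ((2 * 2 - 1) * l' - 1) ≤ (2 - 1) * V') :
    2 * (l' * (z * (ε + 1 - V) * (ε + 1 - V') +
        (1 - z * (1 + ε)) * ((ε + 1 - V) + (ε + 1 - V') - 1 - ε))) ≤
      (1 - (2 - 1) * l') * (ε + 1 - V) := by
  have E1 := branch_end_one hε0 hε1 hl'0 hl'1 hV'0 hwl'
  have E0 := branch_end_eps hz hε0 hw hl'0 hl'1 hV'0 hwl'
  have e : (1 - (2 - 1) * l') * (ε + 1 - V) -
      2 * (l' * (z * (ε + 1 - V) * (ε + 1 - V') +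
        (1 - z * (1 + ε)) * ((ε + 1 - V) + (ε + 1 - V') - 1 - ε))) =
      (1 - V) * ((1 + ε) * (1 - 3 * l') + 2 * l' * V') + V * (ε * (1 - 3 * l') + 2 * l' * (1 - z) * V') := by
    ring
  nlinarith [mul_nonneg (by linarith : (0:ℝ) ≤ 1 - V) E1, mul_nonneg hV0 E0]

/-! ## 3. The criterion at the endpoint -/

/-- **The region criterion holds at the tight endpoint.**  For `β = 2`, floor `Vmin = 0`, exponent
`κ_S`, and every `(z, ε)` with `3/4 ≤ z`, `0 ≤ ε ≤ 1/3`, `z(1+ε) ≤ 1`: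
`RegionCriterion 2 z ε 0 κ_S`.  (Only the wedge constraint of the pinned region is used.) -/
theorem regionCriterion_two_floorZero {z ε : ℝ} (hz : 3 / 4 ≤ z) (hε0 : 0 ≤ ε) (hε1 : ε ≤ 1 / 3)
    (hw : z * (1 + ε) ≤ 1) : RegionCriterion 2 z ε 0 (Real.log (4 / 3) / Real.log 2) := by
  intro l l' V V' VP hl hl1 hl' hl'1 hV0 hV1 hV'0 hV'1 hwl hwl' _ _ hP _ x hx0 hx1
  -- the two factor coefficients are nonnegative
  have hA : 0 ≤ (1 - (2 - 1) * l') * (l * (ε + 1 - V)) :=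
    mul_nonneg (by linarith) (mul_nonneg hl.le (by linarith))
  have hB : 0 ≤ (1 - (2 - 1) * l) * (l' * (ε + 1 - V')) :=
    mul_nonneg (by linarith) (mul_nonneg hl'.le (by linarith))
  -- defect D and the two branch inequalities 2D ≤ A, 2D ≤ B
  set D := l * l' * (z * (ε + 1 - V) * (ε + 1 - V') +
      (1 - z * (1 + ε)) * ((ε + 1 - V) + (ε + 1 - V') - 1 - ε)) with hD
  have hDA : 2 * D ≤ (1 - (2 - 1) * l') * (l * (ε + 1 - V)) := by
    have h := branch_ineq (V := V) (V' := V') hz hε0 hε1 hw hl'.le hl'1 hV0 hV1 hV'0 hwl'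
    have := mul_le_mul_of_nonneg_left h hl.le
    have e1 : l * (2 * (l' * (z * (ε + 1 - V) * (ε + 1 - V') +
        (1 - z * (1 + ε)) * ((ε + 1 - V) + (ε + 1 - V') - 1 - ε)))) = 2 * D := by rw [hD]; ring
    have e2 : l * ((1 - (2 - 1) * l') * (ε + 1 - V)) = (1 - (2 - 1) * l') * (l * (ε + 1 - V)) := by ring
    linarith [e1, e2]
  have hDB : 2 * D ≤ (1 - (2 - 1) * l) * (l' * (ε + 1 - V')) := by
    have h := branch_ineq (V := V') (V' := V) hz hε0 hε1 hw hl.le hl1 hV'0 hV'1 hV0 hwl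
    have := mul_le_mul_of_nonneg_left h hl'.le
    have e1 : l' * (2 * (l * (z * (ε + 1 - V') * (ε + 1 - V) +
        (1 - z * (1 + ε)) * ((ε + 1 - V') + (ε + 1 - V) - 1 - ε)))) = 2 * D := by rw [hD]; ring
    have e2 : l' * ((1 - (2 - 1) * l) * (ε + 1 - V')) = (1 - (2 - 1) * l) * (l' * (ε + 1 - V')) := by ring
    linarith [e1, e2]
  -- the right-hand side equals A + B − D
  have hR : (l + l' - (2 * 2 - 1) * l * l') * (ε + 1 - VP) =
      (1 - (2 - 1) * l') * (l * (ε + 1 - V)) + (1 - (2 - 1) * l) * (l' * (ε + 1 - V')) - D := by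
    have e : (l + l' - (2 * 2 - 1) * l * l') * (ε + 1 - VP) =
        (l + l' - (2 * 2 - 1) * l * l') * (ε + 1) - VP * (l + l' - (2 * 2 - 1) * l * l') := by ring
    rw [e, hP, hD]
    linarith [defect_identity z ε l l' V V']
  -- chord bound + min(A,B)/2 ≥ D
  have hmin : D ≤ min ((1 - (2 - 1) * l') * (l * (ε + 1 - V))) ((1 - (2 - 1) * l) * (l' * (ε + 1 - V'))) / 2 := by
    rcases min_choice ((1 - (2 - 1) * l') * (l * (ε + 1 - V))) ((1 - (2 - 1) * l) * (l' * (ε + 1 - V'))) with h | h <;>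
      rw [h] <;> linarith
  rw [hR]
  linarith [chord_bound (x := x) hA hB hx0 hx1]

/-- The instance used for the cap: `(z, ε) = (99/100, 1/100)`. -/
theorem regionCriterion_two_99_100 :
    RegionCriterion 2 (99 / 100) (1 / 100) 0 (Real.log (4 / 3) / Real.log 2) :=
  regionCriterion_two_floorZero (by norm_num) (by norm_num) (by norm_num) (by norm_num)

/-- The limit instance `(z, ε) = (1, 0)`. -/
theorem regionCriterion_two_one_zero :
    RegionCriterion 2 1 0 0 (Real.log (4 / 3) / Real.log 2) :=
  regionCriterion_two_floorZero (by norm_num) le_rfl (by norm_num) (by norm_num)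

/-- **XL-D at the tight endpoint, every arity.**  For every `a ≥ 2` the dial `(a, 2)` satisfies XL-D (model
level): every admissible schedule's cost deviation is `O(log-size^{κ_S})` for every threshold-respecting seed.
This is the one dial value no vertex certificate can reach (XLIII: margin `0` at the fixed-point pair). -/
theorem capXLD_allA_two {a : ℝ} (ha : 2 ≤ a) :
    ∀ R : ℝ, 0 ≤ R → ∀ y₀ : ℝ → ℝ, (∀ b : ℝ, 0 ≤ b → 0 ≤ y₀ b ∧ y₀ b ≤ R / (b + 2)) →
      ∃ C : ℝ, ∀ s : Sched, Admissible a 2 s →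
        dev 2 y₀ s ≤ C * logSize 2 s ^ (Real.log (4 / 3) / Real.log 2) :=
  capXLD_allA_of_criterion 0 ha (by norm_num) le_rfl (by norm_num) (by norm_num) (by norm_num)
    (Vfloor_two_eq_zero (a := 2) (by norm_num) (99 / 100) 0).ge regionCriterion_two_99_100

/-! ## 4. `κ_S` is the exact threshold at the endpoint -/

/-- Monotonicity of the criterion in the exponent (on `[0,1]`, `x^κ` decreases in `κ`). -/
theorem regionCriterion_mono_kappa {β z ε Vmin κ κ' : ℝ} (hκ : 0 < κ) (hκκ' : κ ≤ κ') (hβ : 1 ≤ β)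
    (hε : ∀ lam V : ℝ, 0 < lam → β * lam ≤ 1 → Vmin ≤ V → V ≤ 1 → 0 ≤ lam * (ε + 1 - V))
    (h : RegionCriterion β z ε Vmin κ) : RegionCriterion β z ε Vmin κ' := by
  intro l l' V V' VP hl hl1 hl' hl'1 hV0 hV1 hV'0 hV'1 hwl hwl' hp hp' hP hVP x hx0 hx1
  have h0 := h l l' V V' VP hl hl1 hl' hl'1 hV0 hV1 hV'0 hV'1 hwl hwl' hp hp' hP hVP x hx0 hx1
  have hxk : x ^ κ' ≤ x ^ κ := by
    rcases hx0.lt_or_eq with hx | hx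
    · exact Real.rpow_le_rpow_of_exponent_ge hx hx1 hκκ'
    · rw [← hx, Real.zero_rpow hκ.ne', Real.zero_rpow (lt_of_lt_of_le hκ hκκ').ne']
  have hyk : (1 - x) ^ κ' ≤ (1 - x) ^ κ := by
    rcases (sub_nonneg.mpr hx1).lt_or_eq with hx | hx
    · exact Real.rpow_le_rpow_of_exponent_ge hx (by linarith) hκκ'
    · rw [← hx, Real.zero_rpow hκ.ne', Real.zero_rpow (lt_of_lt_of_le hκ hκκ').ne']
  have hl1' : l ≤ 1 := by nlinarith
  have hl'1' : l' ≤ 1 := by nlinarith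
  have hA : 0 ≤ (1 - (β - 1) * l') * (l * (ε + 1 - V)) :=
    mul_nonneg (by nlinarith) (hε l V hl hl1 hV0 hV1)
  have hB : 0 ≤ (1 - (β - 1) * l) * (l' * (ε + 1 - V')) :=
    mul_nonneg (by nlinarith) (hε l' V' hl' hl'1 hV'0 hV'1)
  nlinarith [mul_le_mul_of_nonneg_left hxk hA, mul_le_mul_of_nonneg_left hyk hB]

/-- **Exact threshold at the endpoint.**  For `β = 2`, floor `0` and `(z, ε)` as above, the region criterion
at exponent `κ` holds **iff `κ_S ≤ κ`** (`⇒`: XLIII `kappaS_le_of_regionCriterion_two`; `⇐`: this file). -/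
theorem regionCriterion_two_iff {z ε κ : ℝ} (hz : 3 / 4 ≤ z) (hε0 : 0 ≤ ε) (hε1 : ε ≤ 1 / 3)
    (hw : z * (1 + ε) ≤ 1) :
    RegionCriterion 2 z ε 0 κ ↔ Real.log (4 / 3) / Real.log 2 ≤ κ := by
  constructor
  · exact kappaS_le_of_regionCriterion_two (by linarith) le_rfl
  · intro hk
    refine regionCriterion_mono_kappa kappaS_pos hk (by norm_num) ?_ (regionCriterion_two_floorZero hz hε0 hε1 hw)
    intro lam V hl _ _ hV1
    exact mul_nonneg hl.le (by linarith)

/-! ## 5. The tight locus contains the faces `V = 1` (limit regulariser `(z, ε) = (1, 0)`) -/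

/-- At `(β, z, ε) = (2, 1, 0)` and `V = 1` the right-hand side of the pair inequality equals the second
coefficient `B` exactly: `λ_P (1 − V_P) = (1 − λ) λ' (1 − V')`. -/
theorem endpoint_face_identity {l l' V' VP : ℝ}
    (hP : VP * (l + l' - (2 * 2 - 1) * l * l') =
      l' * (1 - 2 * l) * V' + l * (1 - 2 * l') * 1 + 1 * l * l' * 1 * V') :
    (l + l' - (2 * 2 - 1) * l * l') * (0 + 1 - VP) = (1 - (2 - 1) * l) * (l' * (0 + 1 - V')) := by
  have e : (l + l' - (2 * 2 - 1) * l * l') * (0 + 1 - VP) =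
      (l + l' - (2 * 2 - 1) * l * l') - VP * (l + l' - (2 * 2 - 1) * l * l') := by ring
  rw [e, hP]
  ring

/-- Hence on the face `V = 1` the pair inequality at `(2, 1, 0)` is an EQUALITY at `x = 0` (tight locus). -/
theorem endpoint_face_tight {l l' V' VP κ : ℝ} (hκ : 0 < κ)
    (hP : VP * (l + l' - (2 * 2 - 1) * l * l') =
      l' * (1 - 2 * l) * V' + l * (1 - 2 * l') * 1 + 1 * l * l' * 1 * V') :
    (1 - (2 - 1) * l') * (l * (0 + 1 - 1)) * (0 : ℝ) ^ κ +
        (1 - (2 - 1) * l) * (l' * (0 + 1 - V')) * (1 - 0 : ℝ) ^ κ =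
      (l + l' - (2 * 2 - 1) * l * l') * (0 + 1 - VP) := by
  rw [endpoint_face_identity hP, Real.zero_rpow hκ.ne', sub_zero, Real.one_rpow]
  ring

end Summit.MatrixMultiplication.MatrixMultiplication.Theorems.FarEdgeDescentEndpointCriterion

end
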